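import Summits.Ventures.PercRepro.PuncturedLYMSparsePaving
import Summits.Ventures.PercRepro.ProfilePointedPaving

/-!
# PercRepro — THE PAVING BRIDGE: (NC) FOR A PAVING MATROID ON `r + 1 ≤ n ≤ 2r − 2` ELEMENTS REDUCES TO THE
PUNCTURED NORMALISED MATCHING PROPERTY OF ITS CO-CODE (p10, gen 33)

The sparse-paving bridge (PuncturedLYMSparsePaving) used only two facts about the matroid: every set with fewer than
`r` elements is independent, and (SP) for the family of complements of the dependent `r`-sets.  For a PAVING matroid
(`IsPaving M`, `rk M (gr M) = r`: every set with fewer than `r` elements is independent) the same holds verbatim, except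
that the co-code `cocode M r` (the complements of the dependent `r`-sets) is no longer a code: two dependent `r`-sets may
share `r − 1` points (several co-words inside one `(j+1)`-set).  The statement `PuncturedNMP j (cocode M r)` makes
sense for any family, and:
* `biIndepSets_eq_punctured_of_paving`, `biIndepSets_succ_eq_levelAbove_of_paving`, `clF_eq_self_of_card_eq_of_paving`
  — the bottom level `j = n − r` of the bi-independent complex is the punctured level of the co-code, the level above is
  full, every `j`-set is its own closure (`n + 2 ≤ 2r`);
* `normConsStep_bottom_of_puncturedNMP_of_paving` — the bottom step of (NC) from `PuncturedNMP j (cocode M r)`;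
* **`normConsAt_of_paving_of_puncturedNMP`** — **(NC) holds for every paving matroid on `E = univ` with
  `r + 1 ≤ n ≤ 2r − 2` whose co-code has the punctured normalised matching property** (the other steps are the
  unconditional steps of gen 29: below the bottom, Boolean in the middle, top);
* `PavingNMP` — **CONJECTURE (PAV), NOT asserted**: the co-code of every paving matroid in that range has the punctured
  normalised matching property — equivalently (complementation) the bipartite graph between the bases and ALL
  `(r−1)`-sets has the normalised matching property; `normConsAt_of_paving_of_pavingNMP` is the bridge.
DATA (gen 33, mining/p10/g33/): (PAV) by exact max-flow on 202 random paving matroids with mixed hyperplane sizes on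
`n ≤ 12` and on structured ones (grids, `AG(2,3)`, near-pencils, a large hyperplane plus a packing of `r`-sets, two large
hyperplanes) up to `n = 16`: 0 failures; the cell's (NMP-I) census on all matroids with `n ≤ 9` contains it.
Nothing here asserts (NC), (SP) or (PAV).
-/

open scoped Matroid

namespace PercRepro.Cogirth

open Finset ThmH Skew

variable {α : Type} [Fintype α] [DecidableEq α] {M : Matroid α} [M.Finite]

omit [Fintype α] [DecidableEq α] in
/-- In a paving matroid of rank `r` every subset with at most `r − 1` elements is independent. -/
theorem rk_eq_card_of_card_lt_of_paving {r : ℕ} (hp : IsPaving M) (hrk : rk M (gr M) = r)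
    {S : Finset α} (hS : S ⊆ gr M) (hSc : S.card + 1 ≤ r) : rk M S = S.card :=
  hp S hS (by omega)

omit [Fintype α] in
/-- A sparse paving matroid is paving. -/
theorem isPaving_of_sparsePaving {r : ℕ} (hsp : IsSparsePavingF M r) : IsPaving M := by
  intro S hS hSc
  have hr : r ≤ (gr M).card := by
    have := hsp.1 ▸ rk_le_card (gr M)
    omega
  rw [hsp.1] at hSc
  exact rk_eq_card_of_card_lt_of_sparsePaving hsp hr hS hSc

/-- The bi-independent `(n − r)`-sets of a paving matroid are the punctured level of the co-code (`E = univ`,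
`n + 2 ≤ 2r`). -/
theorem biIndepSets_eq_punctured_of_paving {r : ℕ} (hp : IsPaving M) (hrk : rk M (gr M) = r) (hE : gr M = univ)
    (hn : (gr M).card + 2 ≤ 2 * r) :
    biIndepSets M ((gr M).card - r) = PuncturedLYM.punctured ((gr M).card - r) (cocode M r) := by
  ext X
  rw [mem_biIndepSets, PuncturedLYM.mem_punctured, mem_cocode]
  constructor
  · rintro ⟨hXg, hXc, -, hXd⟩
    refine ⟨hXc, ?_⟩
    rintro ⟨-, h⟩
    exact h hXd
  · rintro ⟨hXc, hXD⟩
    have hXg : X ⊆ gr M := by rw [hE]; exact subset_univ X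
    refine ⟨hXg, hXc, rk_eq_card_of_card_lt_of_paving hp hrk hXg (by omega), ?_⟩
    by_contra h
    exact hXD ⟨⟨hXg, hXc⟩, h⟩

/-- The bi-independent `(n − r + 1)`-sets of a paving matroid are all the `(n − r + 1)`-sets (`E = univ`,
`n + 2 ≤ 2r`). -/
theorem biIndepSets_succ_eq_levelAbove_of_paving {r : ℕ} (hp : IsPaving M) (hrk : rk M (gr M) = r)
    (hE : gr M = univ) (hn : (gr M).card + 2 ≤ 2 * r) :
    biIndepSets M ((gr M).card - r + 1) = PuncturedLYM.levelAbove α ((gr M).card - r) := by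
  have hr : r ≤ (gr M).card := by
    have := hrk ▸ rk_le_card (gr M)
    omega
  rw [PuncturedLYM.levelAbove, ← hE]
  apply biIndepSets_eq_powersetCard_of_indep_of_indep
  · intro S hS hSc
    exact rk_eq_card_of_card_lt_of_paving hp hrk hS (by omega)
  · intro S hS hSc
    exact rk_eq_card_of_card_lt_of_paving hp hrk hS (by omega)

omit [Fintype α] in
/-- Every `(n − r)`-set of a paving matroid is its own closure (`n + 2 ≤ 2r`). -/
theorem clF_eq_self_of_card_eq_of_paving {r : ℕ} (hp : IsPaving M) (hrk : rk M (gr M) = r)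
    (hn : (gr M).card + 2 ≤ 2 * r) {X : Finset α} (hX : X ⊆ gr M) (hXc : X.card = (gr M).card - r) :
    clF M X = X := by
  have hr : r ≤ (gr M).card := by
    have := hrk ▸ rk_le_card (gr M)
    omega
  apply clF_eq_self_of_indep_succ' _ hX hXc
  intro S hS hSc
  exact rk_eq_card_of_card_lt_of_paving hp hrk hS (by omega)

/-- **The bottom step of (NC) for a paving matroid follows from the punctured normalised matching property of its
co-code** (`E = univ`, `n + 2 ≤ 2r`). -/
theorem normConsStep_bottom_of_puncturedNMP_of_paving {r : ℕ} (hp : IsPaving M) (hrk : rk M (gr M) = r)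
    (hE : gr M = univ) (hn : (gr M).card + 2 ≤ 2 * r) {U : Finset (Finset α)} (hU : UpFlats M U)
    (hSP : PuncturedLYM.PuncturedNMP ((gr M).card - r) (cocode M r)) :
    NormConsStep M U ((gr M).card - r) := by
  set j := (gr M).card - r with hj
  unfold NormConsStep upCount
  rw [biIndepSets_eq_punctured_of_paving hp hrk hE hn, biIndepSets_succ_eq_levelAbove_of_paving hp hrk hE hn]
  set 𝒜 := (PuncturedLYM.punctured j (cocode M r)).filter (fun X => X ∈ U) with h𝒜
  have h𝒜P : 𝒜 ⊆ PuncturedLYM.punctured j (cocode M r) := filter_subset _ _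
  have hbot : (PuncturedLYM.punctured j (cocode M r)).filter (fun X => clF M X ∈ U) = 𝒜 := by
    apply filter_congr
    intro X hX
    have hXc := (PuncturedLYM.mem_punctured.1 hX).1
    have hXg : X ⊆ gr M := by rw [hE]; exact subset_univ X
    rw [clF_eq_self_of_card_eq_of_paving hp hrk hn hXg hXc]
  rw [hbot]
  have hup : PuncturedLYM.upNbhd j 𝒜 ⊆ (PuncturedLYM.levelAbove α j).filter (fun Y => clF M Y ∈ U) := by
    intro Y hY
    rw [PuncturedLYM.mem_upNbhd] at hY
    obtain ⟨hYc, X, hX𝒜, hXY⟩ := hY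
    rw [mem_filter, PuncturedLYM.mem_levelAbove]
    refine ⟨hYc, ?_⟩
    have hXU : X ∈ U := (mem_filter.1 hX𝒜).2
    have hYg : Y ⊆ gr M := by rw [hE]; exact subset_univ Y
    have hXcl : X ⊆ clF M Y := hXY.trans (subset_clF_fu hYg)
    exact hU.up X hXU (clF M Y) (isFlatF_clF Y) hXcl
  have h1 := hSP 𝒜 h𝒜P
  have h2 := card_le_card hup
  calc 𝒜.card * (PuncturedLYM.levelAbove α j).card
      ≤ (PuncturedLYM.upNbhd j 𝒜).card * (PuncturedLYM.punctured j (cocode M r)).card := h1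
    _ ≤ ((PuncturedLYM.levelAbove α j).filter (fun Y => clF M Y ∈ U)).card *
        (PuncturedLYM.punctured j (cocode M r)).card := Nat.mul_le_mul_right _ h2

/-- **(NC) HOLDS FOR EVERY PAVING MATROID on `E = univ` with `r + 1 ≤ n` and `n + 2 ≤ 2r` whose co-code has the
punctured normalised matching property** (the bottom step from the hypothesis, the Boolean and top steps of gen 29
elsewhere). -/
theorem normConsAt_of_paving_of_puncturedNMP {r : ℕ} (hp : IsPaving M) (hrk : rk M (gr M) = r) (hE : gr M = univ)
    (hr1 : r + 1 ≤ (gr M).card) (hn : (gr M).card + 2 ≤ 2 * r)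
    (hSP : PuncturedLYM.PuncturedNMP ((gr M).card - r) (cocode M r)) : NormConsAt M := by
  intro U hU j
  rcases Nat.lt_or_ge j ((gr M).card - r) with hlt | hge
  · apply normConsStep_of_lt
    rw [hrk]
    omega
  rcases Nat.eq_or_lt_of_le hge with heq | hgt
  · rw [← heq]
    exact normConsStep_bottom_of_puncturedNMP_of_paving hp hrk hE hn hU hSP
  rcases Nat.lt_or_ge (j + 1) r with hmid | htop
  · apply normConsStep_of_indep_succ_of_indep_sdiff hU (by omega)
    · intro S hS hSc
      exact rk_eq_card_of_card_lt_of_paving hp hrk hS (by omega)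
    · intro S hS hSc
      exact rk_eq_card_of_card_lt_of_paving hp hrk hS (by omega)
  · apply normConsStep_of_rk_le hU
    rw [hrk]
    omega

/-- **CONJECTURE (PAV) (NOT asserted)**: the co-code of every paving matroid of rank `r` on `E = univ` with
`r + 1 ≤ n ≤ 2r − 2` has the punctured normalised matching property — by complementation, the bipartite graph between
the bases and all `(r − 1)`-sets has the normalised matching property. -/
def PavingNMP : Prop :=
  ∀ (α : Type) [Fintype α] [DecidableEq α] (M : Matroid α) [M.Finite] (r : ℕ), IsPaving M → rk M (gr M) = r →
    gr M = univ → r + 1 ≤ (gr M).card → (gr M).card + 2 ≤ 2 * r →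
      PuncturedLYM.PuncturedNMP ((gr M).card - r) (cocode M r)

/-- **(PAV) ⟹ (NC) for every paving matroid on `E = univ` with `r + 1 ≤ n ≤ 2r − 2`.** -/
theorem normConsAt_of_paving_of_pavingNMP (hPAV : PavingNMP) {r : ℕ} (hp : IsPaving M) (hrk : rk M (gr M) = r)
    (hE : gr M = univ) (hr1 : r + 1 ≤ (gr M).card) (hn : (gr M).card + 2 ≤ 2 * r) : NormConsAt M :=
  normConsAt_of_paving_of_puncturedNMP hp hrk hE hr1 hn (hPAV α M r hp hrk hE hr1 hn)

end PercRepro.Cogirth
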